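import Mathlib
import HarnessLib
import Literature.NumberTheory.LFunctions.ZetaScrew
import Literature.NumberTheory.ModularForms.SiegelModularFormsDegreeOne
import Summits.RiemannHypothesis.RiemannHypothesis.Theorems.IntegerScrewDefs

/-!
# Route `IntegerScrew` — NESTED SYLVESTER: `S_{N+1} ≻ 0 ↔ d_2, …, d_{N+1} > 0` for the screw Gram matrices

Pure linear algebra about the nested family `screwMatrix n` (= `S_{n+1}`, nodes `log 2 … log(n+1)`;
`Theorems/IntegerScrewDefs.lean`) and its LDLᵀ pivots `screwPivot M = det S_M / det S_{M−1}`: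

* `screwMatrix_form`, `screwMatrix_form_eq_Icc` — the quadratic form `vᵀ S v` as the route's double sum
  `∑_{2≤m,m'≤n+1} G(log m, log m') x_m x_{m'}`; `screwMatrix_diag` (`S(m,m) = 2Ψ(log m)`).
* `posDef_fromBlocks₁₁` — the STRICT Schur-complement step `[[A,B],[Bᵀ,D]] ≻ 0 ↔ D − BᵀA⁻¹B ≻ 0`
  (`A ≻ 0`; Mathlib has the semidefinite version `Matrix.PosDef.fromBlocks₁₁`).
* `screwMatrix_succ_submatrix` (nestedness as a block identity), `screwDet_succ` (bordered determinant
  `det S_{n+2} = det S_{n+1} · det(c − bᵀS_{n+1}⁻¹b)`), `screwMatrix_submatrix_castLE` (leading blocks).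
* `screwMatrix_posDef_iff_screwPivot_pos_le` — **finite nested Sylvester criterion**
  `S_{N+1} ≻ 0 ↔ (d_M > 0 for all 2 ≤ M ≤ N+1)`: the certificate shape of the pivot ladders («one LDLᵀ
  pass in the natural order certifies every rung ≤ M»); `screwMatrix_posDef_iff_screwPivot_pos` — the
  `∀ M` form; `screwPivot_two` (`d_2 = 2Ψ(log 2)`).

No number theory is used here beyond the symmetry `G(t,u) = G(u,t)` and `G(t,t) = 2Ψ(t)`; the
RH-equivalences built on these lemmas are in `Theorems/IntegerScrewPivotCriterion.lean`.
-/

noncomputable section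

-- D-0017: `Summit.<S>.<S>.…` is the designed namespace of a single-problem summit.
set_option linter.dupNamespace false

namespace Summit.RiemannHypothesis.RiemannHypothesis.Theorems.IntegerScrew

open Literature.NumberTheory.LFunctions Matrix
open Literature.NumberTheory.ModularForms.SiegelModularForm (posDef_fin_one_iff)
open scoped BigOperators

/-! ### The quadratic form of `screwMatrix n` in the route's vocabulary -/

/-- Entries of the screw Gram matrix (definitional). [folklore] -/
theorem screwMatrix_apply (n : ℕ) (i j : Fin n) :
    screwMatrix n i j =
      zetaScrewKernel (Real.log (((i : ℕ) + 2 : ℕ) : ℝ)) (Real.log (((j : ℕ) + 2 : ℕ) : ℝ)) :=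
  rfl

/-- `screwMatrix n` is symmetric (`G` is symmetric because `Ψ` is even). [folklore] -/
theorem screwMatrix_isHermitian (n : ℕ) : (screwMatrix n).IsHermitian :=
  Matrix.IsHermitian.ext fun i j => by
    rw [star_trivial, screwMatrix_apply, screwMatrix_apply, zetaScrewKernel_comm]

/-- The quadratic form `v ↦ vᵀ S v` of `screwMatrix n` as a double sum over `Fin n`. [folklore] -/
theorem screwMatrix_form (n : ℕ) (v : Fin n → ℝ) :
    star v ⬝ᵥ (screwMatrix n *ᵥ v) =
      ∑ i : Fin n, ∑ j : Fin n,
        zetaScrewKernel (Real.log (((i : ℕ) + 2 : ℕ) : ℝ)) (Real.log (((j : ℕ) + 2 : ℕ) : ℝ)) *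
          (v i * v j) := by
  simp only [star_trivial, dotProduct, Matrix.mulVec, screwMatrix_apply, Finset.mul_sum]
  refine Finset.sum_congr rfl fun i _ => Finset.sum_congr rfl fun j _ => ?_
  ring

/-- Re-indexing `∑_{m ∈ [2, n+1]} f(m) = ∑_{i < n} f(i + 2)` (row `i ↔ m = i + 2`). [folklore] -/
theorem sum_Icc_two_eq_sum_fin (f : ℕ → ℝ) (n : ℕ) :
    ∑ m ∈ Finset.Icc 2 (n + 1), f m = ∑ i : Fin n, f ((i : ℕ) + 2) := by
  induction n with
  | zero => simp
  | succ n ih =>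
      rw [Finset.sum_Icc_succ_top (by omega), ih, Fin.sum_univ_castSucc]
      simp only [Fin.val_castSucc, Fin.val_last]

/-- The quadratic form of `screwMatrix n` at `v` is the route's double sum
`∑_{2≤m,m'≤n+1} G(log m, log m') x_m x_{m'}` for any `x : ℕ → ℝ` extending `v` (`x(i+2) = v i`).
[folklore] -/
theorem screwMatrix_form_eq_Icc (n : ℕ) (v : Fin n → ℝ) (x : ℕ → ℝ)
    (hx : ∀ i : Fin n, x ((i : ℕ) + 2) = v i) :
    star v ⬝ᵥ (screwMatrix n *ᵥ v) =
      ∑ m ∈ Finset.Icc 2 (n + 1), ∑ m' ∈ Finset.Icc 2 (n + 1),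
        zetaScrewKernel (Real.log m) (Real.log m') * (x m * x m') := by
  rw [screwMatrix_form]
  simp only [sum_Icc_two_eq_sum_fin, hx]

/-- Diagonal entries: `S(i,i) = G(log m, log m) = 2Ψ(log m)`, `m = i + 2` (Suzuki2023 p. 4,
`G_g(t,t) = 2Ψ(t)`). [cite: Suzuki2023, p. 4] -/
theorem screwMatrix_diag (n : ℕ) (i : Fin n) :
    screwMatrix n i i = 2 * zetaScrew (Real.log (((i : ℕ) + 2 : ℕ) : ℝ)) := by
  rw [screwMatrix_apply, zetaScrewKernel_self]

/-! ### Linear algebra: the strict Schur-complement step and Sylvester's criterion for the nested family -/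

/-- STRICT SCHUR COMPLEMENT: for a real block matrix `[[A, B], [Bᵀ, D]]` with `A ≻ 0`,
`[[A, B], [Bᵀ, D]] ≻ 0 ↔ D − Bᵀ A⁻¹ B ≻ 0` (Mathlib has the semidefinite version
`Matrix.PosDef.fromBlocks₁₁`; same proof via `Matrix.schur_complement_eq₁₁`). [folklore] -/
theorem posDef_fromBlocks₁₁ {m k : Type*} [Fintype m] [DecidableEq m] [Fintype k]
    {A : Matrix m m ℝ} (B : Matrix m k ℝ) (D : Matrix k k ℝ) (hA : A.PosDef) [Invertible A] :
    (Matrix.fromBlocks A B Bᴴ D).PosDef ↔ (D - Bᴴ * A⁻¹ * B).PosDef := by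
  constructor
  · intro h
    refine Matrix.PosDef.of_dotProduct_mulVec_pos
      ((Matrix.IsHermitian.fromBlocks₁₁ B D hA.1).1 h.1) fun y hy => ?_
    have hne : (-((A⁻¹ * B) *ᵥ y)) ⊕ᵥ y ≠ 0 := by
      intro h0
      apply hy
      funext j
      have := congrFun h0 (Sum.inr j)
      simpa using this
    have := h.dotProduct_mulVec_pos hne
    rwa [dotProduct_mulVec, schur_complement_eq₁₁ B D _ _ hA.1, neg_add_cancel, dotProduct_zero,
      zero_add, ← dotProduct_mulVec] at this
  · intro h
    refine Matrix.PosDef.of_dotProduct_mulVec_pos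
      ((Matrix.IsHermitian.fromBlocks₁₁ B D hA.1).2 h.1) fun z hz => ?_
    rw [dotProduct_mulVec, ← Sum.elim_comp_inl_inr z, schur_complement_eq₁₁ B D _ _ hA.1]
    by_cases hy : z ∘ Sum.inr = 0
    · have hx : z ∘ Sum.inl ≠ 0 := by
        intro hx
        apply hz
        funext i
        rcases i with i | j
        · exact congrFun hx i
        · exact congrFun hy j
      rw [hy, mulVec_zero, add_zero]
      apply lt_add_of_pos_of_le
      · rw [← dotProduct_mulVec]
        exact hA.dotProduct_mulVec_pos hx
      · rw [← dotProduct_mulVec]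
        exact h.posSemidef.dotProduct_mulVec_nonneg _
    · apply lt_add_of_le_of_pos
      · rw [← dotProduct_mulVec]
        exact hA.posSemidef.dotProduct_mulVec_nonneg _
      · rw [← dotProduct_mulVec]
        exact h.dotProduct_mulVec_pos hy

/-- NESTEDNESS as a block identity: re-indexed along `Fin n ⊕ Fin 1 ≃ Fin (n+1)`, the matrix
`S_{n+2} = screwMatrix (n+1)` is the bordering `[[S_{n+1}, b], [bᵀ, c]]` of `screwMatrix n` by the
column `screwBorder n` and the corner `screwCorner n`. [folklore] -/
theorem screwMatrix_succ_submatrix (n : ℕ) :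
    (screwMatrix (n + 1)).submatrix (finSumFinEquiv (m := n) (n := 1)) finSumFinEquiv =
      Matrix.fromBlocks (screwMatrix n) (screwBorder n) (screwBorder n)ᴴ (screwCorner n) := by
  ext (i | i) (j | j)
  · simp [screwMatrix_apply, Matrix.fromBlocks]
  · have hj : j = 0 := Fin.fin_one_eq_zero j
    subst hj
    simp [screwMatrix_apply, screwBorder, Matrix.fromBlocks]
  · have hi : i = 0 := Fin.fin_one_eq_zero i
    subst hi
    simp [screwMatrix_apply, screwBorder, Matrix.fromBlocks, zetaScrewKernel_comm]
  · have hi : i = 0 := Fin.fin_one_eq_zero i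
    have hj : j = 0 := Fin.fin_one_eq_zero j
    subst hi; subst hj
    simp [screwMatrix_apply, screwCorner, Matrix.fromBlocks]

/-- BORDERED DETERMINANT: `det S_{n+2} = det S_{n+1} · det(c − bᵀ S_{n+1}⁻¹ b)` whenever `S_{n+1}` is
invertible — so the pivot `d_{n+2}` IS the (1 × 1) Schur complement. [folklore] -/
theorem screwDet_succ (n : ℕ) [Invertible (screwMatrix n)] :
    screwDet (n + 1) =
      screwDet n * (screwCorner n - (screwBorder n)ᴴ * (screwMatrix n)⁻¹ * screwBorder n).det := by
  have h := Matrix.det_submatrix_equiv_self (finSumFinEquiv (m := n) (n := 1)) (screwMatrix (n + 1))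
  rw [screwMatrix_succ_submatrix, Matrix.det_fromBlocks₁₁, Matrix.invOf_eq_nonsing_inv] at h
  rw [screwDet, screwDet, ← h]

/-- The empty matrix `S_1 = screwMatrix 0` is (vacuously) positive definite. [folklore] -/
theorem screwMatrix_zero_posDef : (screwMatrix 0).PosDef :=
  Matrix.PosDef.of_dotProduct_mulVec_pos (screwMatrix_isHermitian 0) fun x hx =>
    absurd (Subsingleton.elim x 0) hx

/-- `S ≻ 0 ⟹ det S > 0`. [folklore] -/
theorem screwDet_pos_of_posDef {n : ℕ} (h : (screwMatrix n).PosDef) : 0 < screwDet n :=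
  h.det_pos

/-- `d_{n+2} = det S_{n+2} / det S_{n+1} = screwDet (n+1) / screwDet n` (no truncated subtraction).
[folklore] -/
theorem screwPivot_add_two (n : ℕ) : screwPivot (n + 2) = screwDet (n + 1) / screwDet n := by
  simp [screwPivot]

/-- NESTEDNESS as restriction: the leading `n × n` block of `screwMatrix N` (`n ≤ N`) is `screwMatrix n`.
[folklore] -/
theorem screwMatrix_submatrix_castLE {n N : ℕ} (h : n ≤ N) :
    (screwMatrix N).submatrix (Fin.castLE h) (Fin.castLE h) = screwMatrix n := by
  ext i j
  simp [screwMatrix_apply]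

/-- A leading block of a positive definite screw matrix is positive definite. [folklore] -/
theorem screwMatrix_posDef_of_le {n N : ℕ} (h : n ≤ N) (hN : (screwMatrix N).PosDef) :
    (screwMatrix n).PosDef := by
  rw [← screwMatrix_submatrix_castLE h]
  exact hN.submatrix (Fin.castLE_injective h)

/-- SYLVESTER FOR THE NESTED FAMILY, finite form (⇐): if the pivots `d_2, …, d_{N+1}` are positive then
`S_2, …, S_{N+1}` (`screwMatrix n`, `n ≤ N`) are all positive definite — induction on `n` through the
strict Schur-complement step. This is the statement behind «one LDLᵀ pass certifies every rung ≤ M».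
[folklore] -/
theorem screwMatrix_posDef_of_screwPivot_pos_le (N : ℕ)
    (h : ∀ M : ℕ, 2 ≤ M → M ≤ N + 1 → 0 < screwPivot M) :
    ∀ n, n ≤ N → (screwMatrix n).PosDef
  | 0, _ => screwMatrix_zero_posDef
  | n + 1, hn => by
      have hn' := screwMatrix_posDef_of_screwPivot_pos_le N h n (by omega)
      letI : Invertible (screwMatrix n) := hn'.isUnit.invertible
      have hdn : 0 < screwDet n := hn'.det_pos
      have hpiv : 0 < screwDet (n + 1) / screwDet n := by
        rw [← screwPivot_add_two]; exact h (n + 2) (by omega) (by omega)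
      -- the Schur complement is the 1×1 matrix with entry det S_{n+2} / det S_{n+1}
      have hS : (screwCorner n - (screwBorder n)ᴴ * (screwMatrix n)⁻¹ * screwBorder n).PosDef := by
        rw [posDef_fin_one_iff,
          ← Matrix.det_fin_one (screwCorner n - (screwBorder n)ᴴ * (screwMatrix n)⁻¹ * screwBorder n)]
        have hdet := screwDet_succ n
        have : (screwCorner n - (screwBorder n)ᴴ * (screwMatrix n)⁻¹ * screwBorder n).det =
            screwDet (n + 1) / screwDet n := by
          rw [eq_div_iff hdn.ne', mul_comm, ← hdet]
        rw [this]; exact hpiv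
      have hB := (posDef_fromBlocks₁₁ (screwBorder n) (screwCorner n) hn').2 hS
      rw [← screwMatrix_succ_submatrix] at hB
      have := hB.submatrix (e := (finSumFinEquiv (m := n) (n := 1)).symm)
        (finSumFinEquiv (m := n) (n := 1)).symm.injective
      simpa only [Matrix.submatrix_submatrix, Equiv.self_comp_symm, Matrix.submatrix_id_id] using this

/-- SYLVESTER FOR THE NESTED FAMILY, finite form (⇒): if `S_{N+1} ≻ 0` then `d_2, …, d_{N+1} > 0`.
[folklore] -/
theorem screwPivot_pos_of_posDef_le {N : ℕ} (hN : (screwMatrix N).PosDef) (M : ℕ) (hM : 2 ≤ M)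
    (hMN : M ≤ N + 1) : 0 < screwPivot M := by
  obtain ⟨n, rfl⟩ : ∃ n, M = n + 2 := ⟨M - 2, by omega⟩
  rw [screwPivot_add_two]
  exact div_pos (screwMatrix_posDef_of_le (by omega) hN).det_pos
    (screwMatrix_posDef_of_le (by omega) hN).det_pos

/-- **Finite nested Sylvester criterion** (the certificate shape used by the pivot ladders):
`S_{N+1} ≻ 0 ↔ d_M > 0 for all 2 ≤ M ≤ N + 1`; and then every `S_M`, `M ≤ N + 1`, is `≻ 0` as well
(`screwMatrix_posDef_of_le`). [folklore] -/
theorem screwMatrix_posDef_iff_screwPivot_pos_le (N : ℕ) :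
    (screwMatrix N).PosDef ↔ ∀ M : ℕ, 2 ≤ M → M ≤ N + 1 → 0 < screwPivot M :=
  ⟨fun hN M hM hMN => screwPivot_pos_of_posDef_le hN M hM hMN,
    fun h => screwMatrix_posDef_of_screwPivot_pos_le N h N le_rfl⟩

/-- SYLVESTER FOR THE NESTED FAMILY (⇐): if every pivot `d_M`, `M ≥ 2`, is positive then every `S_M`
is positive definite. [folklore] -/
theorem screwMatrix_posDef_of_screwPivot_pos (h : ∀ M : ℕ, 2 ≤ M → 0 < screwPivot M) (n : ℕ) :
    (screwMatrix n).PosDef :=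
  screwMatrix_posDef_of_screwPivot_pos_le n (fun M hM _ => h M hM) n le_rfl

/-- SYLVESTER FOR THE NESTED FAMILY (⇒): if every `S_M` is positive definite then every pivot
`d_M = det S_M / det S_{M−1}`, `M ≥ 2`, is positive. [folklore] -/
theorem screwPivot_pos_of_posDef (h : ∀ n, (screwMatrix n).PosDef) (M : ℕ) (hM : 2 ≤ M) :
    0 < screwPivot M := by
  obtain ⟨n, rfl⟩ : ∃ n, M = n + 2 := ⟨M - 2, by omega⟩
  rw [screwPivot_add_two]
  exact div_pos (h (n + 1)).det_pos (h n).det_pos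

/-- **Nested Sylvester criterion**: `(∀ M, S_M ≻ 0) ↔ (∀ M ≥ 2, d_M > 0)`. [folklore] -/
theorem screwMatrix_posDef_iff_screwPivot_pos :
    (∀ n, (screwMatrix n).PosDef) ↔ ∀ M : ℕ, 2 ≤ M → 0 < screwPivot M :=
  ⟨screwPivot_pos_of_posDef, fun h n => screwMatrix_posDef_of_screwPivot_pos h n⟩

/-- The base pivot: `d_2 = det S_2 = 2Ψ(log 2)` (the directive's "`S₁ > 0`" clause is `d_2 > 0`).
[folklore] -/
theorem screwPivot_two : screwPivot 2 = 2 * zetaScrew (Real.log 2) := by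
  rw [screwPivot_add_two 0]
  have h0 : screwDet 0 = 1 := by simp [screwDet, Matrix.det_isEmpty]
  have h1 : screwDet 1 = 2 * zetaScrew (Real.log 2) := by
    rw [screwDet, Matrix.det_fin_one, screwMatrix_diag]
    norm_num
  rw [h0, h1, div_one]

end Summit.RiemannHypothesis.RiemannHypothesis.Theorems.IntegerScrew
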